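import Summits.Ventures.HSemireg.AmplificationChainG2n
import Summits.Ventures.HSemireg.AmplificationChainG4Transport
import Summits.Ventures.HSemireg.AmplificationChainSigmaGluable
import HarnessLib

/-!
# Venture HSemireg — the level-`N` census-row ladder theorem with the `Ext`-side binders stated on the SOURCE of a derived
# equivalence (the `g = 2N` form of seat p7's `…_of_extRank_eq` ∕ `…_of_local_ff_single` at `g = 4`)

HONEST FRAMING. Lean index of the computation cell `pub-hsemireg` (Sunday typer seat p11 «assembly g = 2n», successor generation;
an ADAPTER leaf, nothing new in content). Every row of the cell's censuses whose object is `E = Φ(G)` for a Fourier–Mukai ∕ derived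
equivalence `Φ` — the STEP-0 object `Φ(I_p ⊠ I_q) ⊗ M`, the THETA-SECANT rows `Φ(E_m) ⊗ M`, family A ∕ C images — certifies its
`Ext` numbers ON THE SOURCE `G` (FM-INV reading of record: `dim Extⁱ(Φ G, Φ G) = dim Extⁱ(G, G)`), while the rank door reads the CLASS
of `E` on the TARGET. At `g = 4` seat p7 typed exactly this transport (`AmplificationChainG4Transport.lean` §3:
`weilFourfoldsSplit_of_reach_of_perfectComplexRankTransfer_of_extRank_eq` ∕ `…_of_local_ff_single`, over seat p6's
`extRank_eq_of_local_ff` ∕ `extRank_single_neg_eq_zero`); p11 g0's level-`N` file carries the `HasSeedOn` half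
(`hasSeedOn_rankObjClass_of_extRank_eq`, `AmplificationChainG2n.lean` §5). This leaf composes the two at level `N`: the census-row
LADDER theorem with (a) the `Ext` clauses on an arbitrary source complex `G` plus `hext : extRank P.X E m = extRank Y₀ G m` (`m ≤ 2`),
its DECIDING-ROW (cell) twin over `weilFamilyReach_similar`, and (b) the «local fully-faithful, single sheaf» form — `G = G₀[0]` a sheaf on `Y₀`, `Φ` an additive ℂ-linear shift-commuting
functor between the derived categories with `Φ(G₀[0]) ≅ E` and `Φ.map` bijective on `Hom(G₀[0], G₀[0]⟦n⟧)` for `n ≤ 2` (then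
`Ext^{<0}` vanishes for free, `extRank_single_neg_eq_zero`). Hypotheses BY NAME: `weilFamilyReach_hyperbolic` (REFEREED, Deligne) and the
venture's ASSUMPTION `PerfectComplexRankTransfer C` (F-1: the local variational Hodge statement for rank-admissible perfect complexes, of
printed strength only on paper via [BuchweitzFlenner2008HH] Prop. 6.4.4 + [Pridham2024Semiregularity] Cor. 2.25 ∕ Rem. 2.27 ∕ [Perry2022]
Prop. 8.1; the kernel links it to none of them). Everything else BY VALUE (the split anchor, `w`, `I`, `E`, `G`, the class identities,
the `Ext` numbers, the rank certificate `extRank Y₀ G 2 ≤ r(P, ch E)`). NOTHING about any explicit variety is asserted; by the signed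
verdict (VERDICT-G6.md v1.0 `1651dcc7322662a2`) no census row instantiates these binders on a deciding component. 0 `sorry`, 0 `def`,
0 new named fact. §2 adds the level-`N` LADDER in the GLUABLE σ-class currency of `AmplificationChainSigmaGluable.lean` (rung R5
WITHOUT `Hom = ℂ`: BY NAME `weilFamilyReach_hyperbolic`, `PridhamPerfectLifts C` and Lieblich-type versal charts; the `g = 4` row is
`weilFourfoldsSplit_of_reach_of_pridhamPerfect_of_versalCharts_of_gluableComplex`, the `g = 6` cell form
`weilSixfoldComponent_of_reachSimilar_of_pridhamPerfect_of_versalCharts_of_gluableComplex`). NOTHING HERE SAYS THAT HC, HC_CM OR HC_AV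
IS PROVED.
-/

noncomputable section

open CategoryTheory AlgebraicGeometry
open Literature.AlgebraicGeometry Literature.AlgebraicGeometry.Motives Literature.AlgebraicGeometry.HodgeTheory
open Literature.AlgebraicGeometry.ModuliOfAbelianVarieties Literature.AlgebraicGeometry.Deligne1982
open Literature.AlgebraicGeometry.KTheory Literature.AlgebraicGeometry.VanGeemen1994
open Literature.AlgebraicTopology.SingularHomology

namespace Summit.Ventures.HSemireg

open Summit.HodgeConjecture.HodgeConjecture
open Summit.HodgeConjecture.HodgeConjecture.WeilTypeLadder
open Summit.HodgeConjecture.HodgeConjecture.Cruxes.HodgeAbelianVarieties.EStepSecantInduction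
open Summit.HodgeConjecture.HodgeConjecture.Ring2.Hypotheses
open Summit.HodgeConjecture.HodgeConjecture.Ring2.AbelianAll
open Summit.Ventures.HSemireg.GeneralStructure

variable {C : ChernCharacterBetti}

section ExtTransportLadder

/-- **The `g = 2N` census-row LADDER theorem, route (C), with the `Ext` binders on a SOURCE complex.** Granting BY NAME Deligne's
hyperbolic reach (`weilFamilyReach_hyperbolic`, REFEREED) and the venture's ASSUMPTION `PerfectComplexRankTransfer C` (F-1): a split
ℚ(√−d)-Weil anchor `(P, ψ₀, e, a)` of dimension `2N` (`ψ₀² = −d`, `a ≠ 0` rational, hyperbolic for `h_K = symmetrisedClass`), a non-zero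
rational Weil class `w`, a bounded complex of vector bundles `E` on `P` with Markman's class shape (`ch_N = q·h_Kᴺ + w`,
`ch_p = c_p·h_Kᵖ` for `p ∈ I ∖ {N}`, `{1..2N} ⊆ I`), and a complex `G` on any `Y₀` with `extRank P.X E m = extRank Y₀ G m` for `m ≤ 2`,
`Ext^{<0}(G,G) = 0`, `Hom(G,G) = ℂ` and `rank Ext²(G,G) ≤ r(P, ch E)` ⟹ the Weil classes are algebraic on EVERY split ℚ(√−d)-Weil
`2N`-fold AND on every ℚ(√−d)-Weil `2n`-fold for `2 ≤ n < N`. (= `ladder_of_reach_of_perfectComplexRankTransfer_of_complex` fed through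
`hasSeedOn_rankObjClass_of_extRank_eq`; at `N = 2` it is seat p7's `weilFourfoldsSplit_of_reach_of_perfectComplexRankTransfer_of_extRank_eq`.)
Nothing asserted; no census row supplies these binders on a deciding component. [cite: BuchweitzFlenner2008HH, Prop. 6.4.4]
[cite: Pridham2024Semiregularity, Cor. 2.25, Rem. 2.27] [cite: Deligne1982HodgeCycles, proof of Thm. 4.8] -/
theorem ladder_of_reach_of_perfectComplexRankTransfer_of_extRank_eq (hF : weilFamilyReach_hyperbolic)
    (hT : PerfectComplexRankTransfer C) {N d : ℕ} (hN : 1 ≤ N) (hd : 0 < d)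
    (P : AbelianVariety ℂ) (ψ₀ : P ⟶ P) (e : ProjectiveEmbedding P.X) (a : complexBetti (projectiveSpace e.n ℂ) 2)
    (hP : P.dim = 2 * N) (hψ : ψ₀ ≫ ψ₀ = -(d • 𝟙 P)) (ha : IsRationalClass a) (ha0 : a ≠ 0)
    (hhyp : IsHyperbolicWeilType P ψ₀ N (symmetrisedClass d P ψ₀ e a))
    (w : complexBetti P.X (2 * N)) (hwW : w ∈ weilClassesOf P ψ₀ N d) (hwr : IsRationalClass w) (hw0 : w ≠ 0)
    (I : Finset ℕ) (hI : ∀ p : ℕ, 1 ≤ p → p ≤ 2 * N → p ∈ I) (E : CochainComplex P.X.left.Modules ℤ)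
    (hE : IsBoundedVBComplex E) (q : ℚ) (c : ℕ → ℚ)
    (hchN : chPerfect C P.X E hE.isFiniteLocallyFree N = ((q : ℚ) : ℂ) • cupPowTwo (symmetrisedClass d P ψ₀ e a) N + w)
    (hchp : ∀ p ∈ I, p ≠ N →
      chPerfect C P.X E hE.isFiniteLocallyFree p = ((c p : ℚ) : ℂ) • cupPowTwo (symmetrisedClass d P ψ₀ e a) p)
    {Y₀ : SchemeOver ℂ} (G : CochainComplex Y₀.left.Modules ℤ)
    (hext : ∀ m : ℤ, m ≤ 2 → extRank P.X E m = extRank Y₀ G m)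
    (hneg : ∀ k : ℤ, k < 0 → extRank Y₀ G k = 0) (h0 : extRank Y₀ G 0 = 1)
    (h2 : extRank Y₀ G 2 ≤ Cardinal.lift.{1} (contractionRank P fun p ↦ chPerfect C P.X E hE.isFiniteLocallyFree p)) :
    Stubs.WeilAlgebraicSplitHyperplane N d ∧ ∀ n : ℕ, 2 ≤ n → n < N → WeilAlgebraicAll n d := by
  have hS : HasHyperbolicSeedOn (rankObjClass C) N d :=
    hasHyperbolicSeedOn_of_hasSeedOn P ψ₀ e a hP hψ ha ha0 hhyp hwW hwr hw0
      (hasSeedOn_rankObjClass_of_extRank_eq hN P hP _ w I hI E hE q c hchN hchp G hext hneg h0 h2)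
  exact ⟨splitHyperplane_of_reach_of_localVariationalHodgeFor_of_hyperbolicSeedOn hF hN hd hT.localVariationalHodgeFor hS,
    fun n hn hnN ↦ weilAlgebraicAll_of_localVariationalHodgeFor_of_hyperbolicSeedOn_lt hF hT.localVariationalHodgeFor hS hn hnN hd⟩

/-- **The `g = 2N` census-row LADDER theorem, «local fully-faithful, single sheaf» form** (the currency of the STEP-0 object and of
the THETA-SECANT rows: `E ≅ Φ(G₀[0])` for a SHEAF `G₀` on the source and an additive ℂ-linear shift-commuting functor `Φ` between the
derived categories that is bijective on `Hom(G₀[0], G₀[0]⟦n⟧)` for `n ≤ 2` — e.g. any exact equivalence): then `Ext^{<0}` vanishes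
for free (`extRank_single_neg_eq_zero`), the `Ext⁰ ∕ Ext²` numbers are read on `G₀` (`extRank_eq_of_local_ff`), and the conclusion is
the ladder of `ladder_of_reach_of_perfectComplexRankTransfer_of_extRank_eq`. At `N = 2` this is seat p7's
`weilFourfoldsSplit_of_reach_of_perfectComplexRankTransfer_of_local_ff_single`. Same BY NAME hypotheses (Deligne's hyperbolic reach,
REFEREED; `PerfectComplexRankTransfer C`, the venture's ASSUMPTION, F-1); nothing asserted.
[cite: BuchweitzFlenner2008HH, Prop. 6.4.4] [cite: Mukai1981, p. 156 L25–27] [cite: Deligne1982HodgeCycles, proof of Thm. 4.8] -/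
theorem ladder_of_reach_of_perfectComplexRankTransfer_of_local_ff_single (hF : weilFamilyReach_hyperbolic)
    (hT : PerfectComplexRankTransfer C) {N d : ℕ} (hN : 1 ≤ N) (hd : 0 < d)
    (P : AbelianVariety ℂ) (ψ₀ : P ⟶ P) (e : ProjectiveEmbedding P.X) (a : complexBetti (projectiveSpace e.n ℂ) 2)
    (hP : P.dim = 2 * N) (hψ : ψ₀ ≫ ψ₀ = -(d • 𝟙 P)) (ha : IsRationalClass a) (ha0 : a ≠ 0)
    (hhyp : IsHyperbolicWeilType P ψ₀ N (symmetrisedClass d P ψ₀ e a))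
    (w : complexBetti P.X (2 * N)) (hwW : w ∈ weilClassesOf P ψ₀ N d) (hwr : IsRationalClass w) (hw0 : w ≠ 0)
    (I : Finset ℕ) (hI : ∀ p : ℕ, 1 ≤ p → p ≤ 2 * N → p ∈ I) (E : CochainComplex P.X.left.Modules ℤ)
    (hE : IsBoundedVBComplex E) (q : ℚ) (c : ℕ → ℚ)
    (hchN : chPerfect C P.X E hE.isFiniteLocallyFree N = ((q : ℚ) : ℂ) • cupPowTwo (symmetrisedClass d P ψ₀ e a) N + w)
    (hchp : ∀ p ∈ I, p ≠ N →
      chPerfect C P.X E hE.isFiniteLocallyFree p = ((c p : ℚ) : ℂ) • cupPowTwo (symmetrisedClass d P ψ₀ e a) p)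
    {Y₀ : SchemeOver ℂ} (G₀ : Y₀.left.Modules) :
    letI := HasDerivedCategory.standard Y₀.left.Modules
    letI := HasDerivedCategory.standard P.X.left.Modules
    ∀ (Φ : DerivedCategory Y₀.left.Modules ⥤ DerivedCategory P.X.left.Modules) [Φ.Additive] [Φ.Linear ℂ]
      [Φ.CommShift ℤ]
      (_ : Φ.obj (DerivedCategory.Q.obj ((CochainComplex.singleFunctor Y₀.left.Modules 0).obj G₀)) ≅
        DerivedCategory.Q.obj E),
      (∀ n : ℤ, n ≤ 2 → Function.Bijective
        (fun f : (DerivedCategory.Q.obj ((CochainComplex.singleFunctor Y₀.left.Modules 0).obj G₀) ⟶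
          (DerivedCategory.Q.obj ((CochainComplex.singleFunctor Y₀.left.Modules 0).obj G₀))⟦n⟧) ↦ Φ.map f)) →
      extRank Y₀ ((CochainComplex.singleFunctor Y₀.left.Modules 0).obj G₀) 0 = 1 →
      extRank Y₀ ((CochainComplex.singleFunctor Y₀.left.Modules 0).obj G₀) 2 ≤
        Cardinal.lift.{1} (contractionRank P fun p ↦ chPerfect C P.X E hE.isFiniteLocallyFree p) →
      Stubs.WeilAlgebraicSplitHyperplane N d ∧ ∀ n : ℕ, 2 ≤ n → n < N → WeilAlgebraicAll n d := by
  intro Φ _ _ _ eΦ hbij h0 h2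
  letI := HasDerivedCategory.standard Y₀.left.Modules
  letI := HasDerivedCategory.standard P.X.left.Modules
  exact ladder_of_reach_of_perfectComplexRankTransfer_of_extRank_eq hF hT hN hd P ψ₀ e a hP hψ ha ha0 hhyp w hwW hwr hw0 I hI
    E hE q c hchN hchp _ (fun n hn ↦ extRank_eq_of_local_ff _ E Φ eΦ n (hbij n hn))
    (fun k hk ↦ extRank_single_neg_eq_zero G₀ hk) h0 h2

end ExtTransportLadder

section ExtTransportCell

/-- **The `g = 2N` DECIDING-ROW (cell) form with the `Ext` binders on a SOURCE complex** (any cell `(N, d, δ)`, non-split included):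
granting BY NAME Deligne's reach-by-similitude (`weilFamilyReach_similar`, REFEREED) and the venture's ASSUMPTION
`PerfectComplexRankTransfer C` (F-1): a polarized Weil-type `(N, d)` member `(P, ψ₀, h_K)` of the cell `δ` with its Gram placement, a
non-zero rational Weil class `w`, a bounded complex of vector bundles `E` on `P` with Markman's class shape, and a complex `G` on any
`Y₀` with `extRank P.X E m = extRank Y₀ G m` (`m ≤ 2`), `Ext^{<0}(G,G) = 0`, `Hom(G,G) = ℂ`, `rank Ext²(G,G) ≤ r(P, ch E)` ⟹
`WeilClassesComponent N d δ`. (= p11 g0's `weilClassesComponent_of_perfectComplexRankTransfer_of_complex` fed through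
`hasSeedOn_rankObjClass_of_extRank_eq`; the census's family-A rows at the non-split anchors R1 ∕ R3 are of this shape — `Φ`-images
with `Ext` read on the source — and every one of them MISSES CLASS, so nothing is instantiated.)
[cite: BuchweitzFlenner2008HH, Prop. 6.4.4] [cite: Pridham2024Semiregularity, Cor. 2.25, Rem. 2.27]
[cite: Deligne1982HodgeCycles, proof of Thm. 4.8] -/
theorem weilClassesComponent_of_perfectComplexRankTransfer_of_extRank_eq {N d : ℕ} {δ : weilNormResidueGroup d}
    (hF : weilFamilyReach_similar) (hT : PerfectComplexRankTransfer C)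
    {P : AbelianVariety ℂ} {ψ₀ : P ⟶ P} (hW : IsWeilType P ψ₀ N d) (e : ProjectiveEmbedding P.X)
    {a : complexBetti (projectiveSpace e.n ℂ) 2} (haQ : IsRationalClass a) (ha0 : a ≠ 0)
    (hδ : HasWeilDiscriminantNondeg P ψ₀ N d (symmetrisedClass d P ψ₀ e a) δ)
    (w : complexBetti P.X (2 * N)) (hwW : w ∈ weilClassesOf P ψ₀ N d) (hwQ : IsRationalClass w) (hw0 : w ≠ 0)
    (I : Finset ℕ) (hI : ∀ p : ℕ, 1 ≤ p → p ≤ 2 * N → p ∈ I) (E : CochainComplex P.X.left.Modules ℤ)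
    (hE : IsBoundedVBComplex E) (q : ℚ) (c : ℕ → ℚ)
    (hchN : chPerfect C P.X E hE.isFiniteLocallyFree N = ((q : ℚ) : ℂ) • cupPowTwo (symmetrisedClass d P ψ₀ e a) N + w)
    (hchp : ∀ p ∈ I, p ≠ N →
      chPerfect C P.X E hE.isFiniteLocallyFree p = ((c p : ℚ) : ℂ) • cupPowTwo (symmetrisedClass d P ψ₀ e a) p)
    {Y₀ : SchemeOver ℂ} (G : CochainComplex Y₀.left.Modules ℤ)
    (hext : ∀ m : ℤ, m ≤ 2 → extRank P.X E m = extRank Y₀ G m)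
    (hneg : ∀ k : ℤ, k < 0 → extRank Y₀ G k = 0) (h0 : extRank Y₀ G 0 = 1)
    (h2 : extRank Y₀ G 2 ≤ Cardinal.lift.{1} (contractionRank P fun p ↦ chPerfect C P.X E hE.isFiniteLocallyFree p)) :
    WeilClassesComponent N d δ :=
  weilClassesComponent_of_perfectComplexRankTransfer_of_seedOn_member C hF hT hW e haQ ha0 hδ hwW hwQ hw0
    (hasSeedOn_rankObjClass_of_extRank_eq hW.pos P hW.dim_eq _ w I hI E hE q c hchN hchp G hext hneg h0 h2)

end ExtTransportCell

section GluableLadder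

/-- **Gluable-σ seed from a census row, any level `N`** (the object class `perfectObjClass C gluableSigmaAdmissible` of
`AmplificationChainSigmaGluable.lean`: as p11 g0's `hasSeedOn_sigmaObjClass_of_complex` WITHOUT the `Hom(E,E) = ℂ` clause): ON a
complex abelian `2N`-fold `P` with a degree-`2` class `h`, `I ⊇ {1..2N}`, ONE bounded complex of vector bundles `E` concentrated in
`[a', b']` with `Ext^{<0}(E,E) = 0` and `(σ_q(E))_{q+1 ∈ I}` JOINTLY INJECTIVE (`HomComplex.IsISemiregularC`, BY VALUE), and rationals
with `ch_N(E) = q·hᴺ + w`, `ch_p(E) = c_p·hᵖ` off `N` ⟹ `HasSeedOn (perfectObjClass C gluableSigmaAdmissible) N P h w`.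
[cite: BuchweitzFlenner2003, Def. 4.1 and §5 (I-semiregular)] [cite: Markman2025SecantWeil, §1.3 and Cor. 1.3.2 (the class shape; preprint)] -/
theorem hasSeedOn_gluableSigmaObjClass_of_complex {N : ℕ} (hN : 1 ≤ N) (P : AbelianVariety ℂ)
    (h : complexBetti P.X 2) (w : complexBetti P.X (2 * N))
    (I : Finset ℕ) (hI : ∀ p : ℕ, 1 ≤ p → p ≤ 2 * N → p ∈ I) (E : CochainComplex P.X.left.Modules ℤ)
    (hE : IsBoundedVBComplex E) (hneg : ∀ k : ℤ, k < 0 → extRank P.X E k = 0)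
    (a' b' : ℤ) [E.IsStrictlyGE a'] [E.IsStrictlyLE b']
    (hσ : letI := HasDerivedCategory.standard P.X.left.Modules
      HomComplex.IsISemiregularC P.X E a' b' hE.isFiniteLocallyFree {q | q + 1 ∈ I})
    (q : ℚ) (c : ℕ → ℚ) (hchN : chPerfect C P.X E hE.isFiniteLocallyFree N = ((q : ℚ) : ℂ) • cupPowTwo h N + w)
    (hchp : ∀ p ∈ I, p ≠ N → chPerfect C P.X E hE.isFiniteLocallyFree p = ((c p : ℚ) : ℂ) • cupPowTwo h p) :
    HasSeedOn (perfectObjClass C gluableSigmaAdmissible) N P h w :=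
  ⟨I, fun p ↦ chPerfect C P.X E hE.isFiniteLocallyFree p, q, c, hI N hN (by omega),
    ⟨E, hE, ⟨hI, hneg, a', b', inferInstance, inferInstance, hE.isFiniteLocallyFree, hσ⟩, fun _ _ ↦ rfl⟩, hchN, hchp⟩

/-- **The `g = 2N` census-row LADDER theorem on rung R5 in the GLUABLE σ-class** (no `Hom = ℂ`): granting BY NAME Deligne's
hyperbolic reach (`weilFamilyReach_hyperbolic`, REFEREED), (F) `PridhamPerfectLifts C` (Pridham 2024's printed + refereed statement,
typed venture-side on the real `σ`-carrier; hypothesis by name, undischarged) and Lieblich-type versal charts in EXISTENCE form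
(`HasVersalPerfectChartAt` for every bounded complex of vector bundles with `Ext^{<0} = 0` on every smooth projective family over a
smooth base; EGA IV₄ 17 is KERNEL via theory seat 3 / lit-3): a split ℚ(√−d)-Weil anchor of dimension `2N`, `w ≠ 0` rational Weil,
`I ⊇ {1..2N}`, ONE bounded complex of vector bundles `E` in `[a', b']` with `Ext^{<0}(E,E) = 0`, `(σ_q(E))_{q+1 ∈ I}` jointly injective,
`ch_N(E) = q·h_Kᴺ + w`, `ch_p(E) = c_p·h_Kᵖ` off `N` ⟹ the Weil classes are algebraic on EVERY split ℚ(√−d)-Weil `2N`-fold AND on every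
ℚ(√−d)-Weil `2n`-fold for `2 ≤ n < N`. At `N = 2` the first conjunct is
`weilFourfoldsSplit_of_reach_of_pridhamPerfect_of_versalCharts_of_gluableComplex`; p11 g0's
`ladder_of_reach_of_pridhamPerfect_of_versalCharts_of_complex` is the same row WITH `Hom = ℂ`. Nothing asserted; by the signed verdict
no census row supplies these binders on a deciding component. [cite: Pridham2024Semiregularity, Cor. 2.25; Rem. 2.27]
[cite: Lieblich2006, Thm. 4.2.1] [cite: EGAIV4, Prop. 17.14.2 and Cor. 17.16.3 (i)] [cite: Deligne1982HodgeCycles, proof of Thm. 4.8] -/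
theorem ladder_of_reach_of_pridhamPerfect_of_versalCharts_of_gluableComplex
    (hF : weilFamilyReach_hyperbolic) (hP : PridhamPerfectLifts C)
    (hV : ∀ ⦃𝒳 S : SchemeOver ℂ⦄ (π : 𝒳 ⟶ S) (n : ℕ),
      IsSmoothProjectiveFamily π n → _root_.AlgebraicGeometry.Smooth S.hom →
      ∀ (s₀ : ComplexPoints S) (X₀ : SchemeOver ℂ) (e : X₀ ≅ fiberOver π s₀)
        (E : CochainComplex X₀.left.Modules ℤ), IsBoundedVBComplex E →
        (∀ k : ℤ, k < 0 → extRank X₀ E k = 0) → HasVersalPerfectChartAt π s₀ X₀ e E)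
    {N d : ℕ} (hN : 1 ≤ N) (hd : 0 < d)
    (P : AbelianVariety ℂ) (ψ₀ : P ⟶ P) (e : ProjectiveEmbedding P.X) (a : complexBetti (projectiveSpace e.n ℂ) 2)
    (hP2 : P.dim = 2 * N) (hψ : ψ₀ ≫ ψ₀ = -(d • 𝟙 P)) (ha : IsRationalClass a) (ha0 : a ≠ 0)
    (hhyp : IsHyperbolicWeilType P ψ₀ N (symmetrisedClass d P ψ₀ e a))
    (w : complexBetti P.X (2 * N)) (hwW : w ∈ weilClassesOf P ψ₀ N d) (hwr : IsRationalClass w) (hw0 : w ≠ 0)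
    (I : Finset ℕ) (hI : ∀ p : ℕ, 1 ≤ p → p ≤ 2 * N → p ∈ I) (E : CochainComplex P.X.left.Modules ℤ)
    (hE : IsBoundedVBComplex E) (hneg : ∀ k : ℤ, k < 0 → extRank P.X E k = 0)
    (a' b' : ℤ) [E.IsStrictlyGE a'] [E.IsStrictlyLE b']
    (hσ : letI := HasDerivedCategory.standard P.X.left.Modules
      HomComplex.IsISemiregularC P.X E a' b' hE.isFiniteLocallyFree {q | q + 1 ∈ I})
    (q : ℚ) (c : ℕ → ℚ)
    (hchN : chPerfect C P.X E hE.isFiniteLocallyFree N = ((q : ℚ) : ℂ) • cupPowTwo (symmetrisedClass d P ψ₀ e a) N + w)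
    (hchp : ∀ p ∈ I, p ≠ N →
      chPerfect C P.X E hE.isFiniteLocallyFree p = ((c p : ℚ) : ℂ) • cupPowTwo (symmetrisedClass d P ψ₀ e a) p) :
    Stubs.WeilAlgebraicSplitHyperplane N d ∧ ∀ n : ℕ, 2 ≤ n → n < N → WeilAlgebraicAll n d := by
  have hT : LocalVariationalHodgeFor (perfectObjClass C gluableSigmaAdmissible) :=
    (perfectComplexDeformsOverEtaleNbhd_gluable_of_pridhamPerfect_of_versalCharts hP hV).localVariationalHodgeFor
  have hS : HasHyperbolicSeedOn (perfectObjClass C gluableSigmaAdmissible) N d :=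
    hasHyperbolicSeedOn_of_hasSeedOn P ψ₀ e a hP2 hψ ha ha0 hhyp hwW hwr hw0
      (hasSeedOn_gluableSigmaObjClass_of_complex hN P _ w I hI E hE hneg a' b' hσ q c hchN hchp)
  exact ⟨splitHyperplane_of_reach_of_localVariationalHodgeFor_of_hyperbolicSeedOn hF hN hd hT hS,
    fun n hn hnN ↦ weilAlgebraicAll_of_localVariationalHodgeFor_of_hyperbolicSeedOn_lt hF hT hS hn hnN hd⟩

end GluableLadder

end Summit.Ventures.HSemireg

end
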